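import Summits.ABC.ABC.Theorems.TwistAmplificationMazurKaneLawDEExactCount
import Literature.NumberTheory.DiophantineGeometry.AbcShapeSubBox
import Literature.NumberTheory.DiophantineGeometry.AbcShapeGeometrySets

-- Summit.ABC.ABC is the mandated summit-side namespace (single-conjunct summit); the lakefile sets the same option tree-wide.
set_option linter.dupNamespace false

/-!
# Exact short vectors `a² F(Cp) = b² F(Dp)` are few (crux stmt-ABC-2757, stub `de_card_exact_le`)

Helper file for the DE tool (short-vector count) of the line `critical-kloosterman-powerful-moduli`
for the crux `Summit.ABC.ABC.Theses.TwistAmplification.MazurKaneLaw`.  It proves the registered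
stub `de_card_exact_le`: among the tuples `w = (r, ((a, Cp), (b, Dp)))` with a host tuple
`r ∈ subBox Qᶜ X`, `a, b ∈ [-L, L]`, `Cp, Dp ∈ subBox {i₀, i₁} Y × subBox {i₀, i₁} Z`, those with
`(a, b) ≠ (0, 0)` and the *exact* relation `a² F(Cp) = b² F(Dp)` (as integers), where
`F(u, v) = c₂ offVal(u) · c₃ offVal(v)`, number at most
`4 · #subBox Qᶜ X · L · #(subBox {i₀, i₁} Y × subBox {i₀, i₁} Z) · Dτ^(4d+1)`.

Proof: the condition does not involve `r` (factor `#subBox Qᶜ X`, `de_card_exact_abstract`);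
`a, b ≠ 0` since `F > 0`, so passing to `(|a|, |b|)` costs a factor `4` (`de_card_signs_le`);
passing from `(Cp, Dp)` to the values `(F Cp, F Dp)` costs the product of two fibres of `F`, each
of size `≤ τ(C)^d · τ(C)^d ≤ Dτ^{2d}` since every free coordinate divides the value
(`de_card_values_le`, `card_subBox_filter_dvd_le`); the resulting value tuples `((a, C), (b, D))`
with `a² C = b² D` are counted by the landed `de_card_sq_mul_eq_le` (`≤ L · #𝒞 · Dτ`).

No new definitions; folklore counting bookkeeping.
-/

namespace Summit.ABC.ABC.Theorems.MazurKaneLaw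

open Finset
open Literature.NumberTheory.DiophantineGeometry
open Literature.NumberTheory.DiophantineGeometry.AbcShapes

/-- Sign reduction: the tuples `((a, p), (b, q))` with `a, b ∈ [-L, L]`, `(a, b) ≠ (0, 0)` and
`a² F(p) = b² F(q)` (with `F > 0` on `CP`) number at most `4` times the tuples with
`a, b ∈ [1, L]` (naturals) and `a² F(p) = b² F(q)`: map `(a, b) ↦ (|a|, |b|)`, fibres `≤ 4`.
[folklore] -/
theorem de_card_signs_le {α : Type*} (CP : Finset α) (F : α → ℕ) (L : ℕ)
    (hF : ∀ p ∈ CP, 0 < F p) :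
    (((Finset.Icc (-(L : ℤ)) L ×ˢ CP) ×ˢ (Finset.Icc (-(L : ℤ)) L ×ˢ CP)).filter
      (fun e : (ℤ × α) × (ℤ × α) => (e.1.1, e.2.1) ≠ (0, 0) ∧
        (e.1.1 ^ 2 * ((F e.1.2 : ℕ) : ℤ) - e.2.1 ^ 2 * ((F e.2.2 : ℕ) : ℤ)) = 0)).card ≤
    4 * (((Finset.Icc 1 L ×ˢ CP) ×ˢ (Finset.Icc 1 L ×ˢ CP)).filter
      (fun e : (ℕ × α) × (ℕ × α) => e.1.1 ^ 2 * F e.1.2 = e.2.1 ^ 2 * F e.2.2)).card := by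
  classical
  refine Finset.card_le_mul_card_image_of_maps_to
    (f := fun e : (ℤ × α) × (ℤ × α) => ((e.1.1.natAbs, e.1.2), (e.2.1.natAbs, e.2.2)))
    (fun e he => ?_) 4 (fun v hv => ?_)
  · -- the map lands in the positive tuples
    rw [mem_filter, mem_product, mem_product, mem_product, mem_Icc, mem_Icc] at he
    obtain ⟨⟨⟨⟨ha1, ha2⟩, hp⟩, ⟨hb1, hb2⟩, hq⟩, hne, heq⟩ := he
    rw [sub_eq_zero] at heq
    have hFp := hF _ hp
    have hFq := hF _ hq
    have hb0 : e.1.1 = 0 → e.2.1 = 0 := fun h0 => by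
      have h : e.2.1 ^ 2 * ((F e.2.2 : ℕ) : ℤ) = 0 := by rw [← heq, h0]; ring
      rcases mul_eq_zero.mp h with h | h
      · exact (pow_eq_zero_iff two_ne_zero).mp h
      · exfalso; exact hFq.ne' (by exact_mod_cast h)
    have ha0 : e.2.1 = 0 → e.1.1 = 0 := fun h0 => by
      have h : e.1.1 ^ 2 * ((F e.1.2 : ℕ) : ℤ) = 0 := by rw [heq, h0]; ring
      rcases mul_eq_zero.mp h with h | h
      · exact (pow_eq_zero_iff two_ne_zero).mp h
      · exfalso; exact hFp.ne' (by exact_mod_cast h)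
    have ha : e.1.1 ≠ 0 := fun h0 => hne (by rw [h0, hb0 h0])
    have hb : e.2.1 ≠ 0 := fun h0 => hne (by rw [h0, ha0 h0])
    have hnat := congrArg Int.natAbs heq
    rw [Int.natAbs_mul, Int.natAbs_mul, Int.natAbs_pow, Int.natAbs_pow, Int.natAbs_natCast,
      Int.natAbs_natCast] at hnat
    have ha' : 1 ≤ e.1.1.natAbs ∧ e.1.1.natAbs ≤ L := by omega
    have hb' : 1 ≤ e.2.1.natAbs ∧ e.2.1.natAbs ≤ L := by omega
    refine mem_filter.mpr ⟨?_, hnat⟩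
    rw [mem_product, mem_product, mem_product, mem_Icc, mem_Icc]
    exact ⟨⟨ha', hp⟩, hb', hq⟩
  · -- fibres have at most four elements (the signs of `a` and `b`)
    obtain ⟨⟨n₁, p₁⟩, ⟨n₂, p₂⟩⟩ := v
    calc _ ≤ ((({(n₁ : ℤ), -(n₁ : ℤ)} : Finset ℤ) ×ˢ ({p₁} : Finset α)) ×ˢ
          (({(n₂ : ℤ), -(n₂ : ℤ)} : Finset ℤ) ×ˢ ({p₂} : Finset α))).card := by
          refine card_le_card fun e he => ?_
          obtain ⟨-, hfe⟩ := mem_filter.mp he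
          simp only [Prod.mk.injEq] at hfe
          obtain ⟨⟨h1, h2⟩, h3, h4⟩ := hfe
          rw [mem_product, mem_product, mem_product, mem_insert, mem_singleton, mem_singleton,
            mem_insert, mem_singleton, mem_singleton]
          exact ⟨⟨Int.natAbs_eq_iff.mp h1, h2⟩, Int.natAbs_eq_iff.mp h3, h4⟩
      _ ≤ 2 * 1 * (2 * 1) := by
          rw [card_product, card_product, card_product, card_singleton, card_singleton]
          exact Nat.mul_le_mul (Nat.mul_le_mul_right _ card_le_two)
            (Nat.mul_le_mul_right _ card_le_two)
      _ = 4 := rfl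

/-- Value reduction: if every fibre of `F` on `CP` has at most `K` elements, the tuples
`((a, p), (b, q))` (`a, b ∈ [1, L]`, `p, q ∈ CP`) with `a² F(p) = b² F(q)` number at most `K²`
times the value tuples `((a, C), (b, D))` (`C, D ∈ F(CP)`) with `a² C = b² D`. [folklore] -/
theorem de_card_values_le {α : Type*} (CP : Finset α) (F : α → ℕ) (L K : ℕ)
    (hK : ∀ p ∈ CP, (CP.filter (fun p' => F p' = F p)).card ≤ K) :
    (((Finset.Icc 1 L ×ˢ CP) ×ˢ (Finset.Icc 1 L ×ˢ CP)).filter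
      (fun e : (ℕ × α) × (ℕ × α) => e.1.1 ^ 2 * F e.1.2 = e.2.1 ^ 2 * F e.2.2)).card ≤
    K * K * (((Finset.Icc 1 L ×ˢ CP.image F) ×ˢ (Finset.Icc 1 L ×ˢ CP.image F)).filter
      (fun v : (ℕ × ℕ) × (ℕ × ℕ) => v.1.1 ^ 2 * v.1.2 = v.2.1 ^ 2 * v.2.2)).card := by
  classical
  refine Finset.card_le_mul_card_image_of_maps_to
    (f := fun e : (ℕ × α) × (ℕ × α) => ((e.1.1, F e.1.2), (e.2.1, F e.2.2)))
    (fun e he => ?_) (K * K) (fun v hv => ?_)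
  · rw [mem_filter, mem_product, mem_product, mem_product] at he
    obtain ⟨⟨⟨ha, hp⟩, hb, hq⟩, heq⟩ := he
    refine mem_filter.mpr ⟨?_, heq⟩
    rw [mem_product, mem_product, mem_product]
    exact ⟨⟨ha, mem_image_of_mem F hp⟩, hb, mem_image_of_mem F hq⟩
  · obtain ⟨⟨a, C⟩, ⟨b, D⟩⟩ := v
    rw [mem_filter, mem_product, mem_product, mem_product] at hv
    obtain ⟨⟨⟨-, hC⟩, -, hD⟩, -⟩ := hv
    obtain ⟨p₀, hp₀, rfl⟩ := mem_image.mp hC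
    obtain ⟨q₀, hq₀, rfl⟩ := mem_image.mp hD
    calc _ ≤ ((({a} : Finset ℕ) ×ˢ CP.filter (fun p' => F p' = F p₀)) ×ˢ
          (({b} : Finset ℕ) ×ˢ CP.filter (fun p' => F p' = F q₀))).card := by
          refine card_le_card fun e he => ?_
          rw [mem_filter, mem_filter, mem_product, mem_product, mem_product] at he
          obtain ⟨⟨⟨⟨-, hp⟩, -, hq⟩, -⟩, hfe⟩ := he
          simp only [Prod.mk.injEq] at hfe
          obtain ⟨⟨h1, h2⟩, h3, h4⟩ := hfe
          rw [mem_product, mem_product, mem_product, mem_singleton, mem_singleton, mem_filter,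
            mem_filter]
          exact ⟨⟨h1, hp, h2⟩, h3, hq, h4⟩
      _ ≤ K * K := by
          rw [card_product, card_product, card_product, card_singleton, card_singleton, one_mul,
            one_mul]
          exact Nat.mul_le_mul (hK p₀ hp₀) (hK q₀ hq₀)

/-- Abstract form of the exact count: for a host set `R` (on which nothing depends), a finite set
`CP` with a positive function `F` whose fibres have at most `K` elements, the tuples
`(r, ((a, p), (b, q)))` with `a, b ∈ [-L, L]`, `(a, b) ≠ (0, 0)`, `a² F(p) - b² F(q) = 0` number at
most `#R · 4 · K² · #{((a, C), (b, D)) : a, b ∈ [1, L], C, D ∈ F(CP), a² C = b² D}`. [folklore] -/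
theorem de_card_exact_abstract {α β : Type*} (R : Finset β) (CP : Finset α) (F : α → ℕ)
    (L K : ℕ) (hF : ∀ p ∈ CP, 0 < F p)
    (hK : ∀ p ∈ CP, (CP.filter (fun p' => F p' = F p)).card ≤ K) :
    ((R ×ˢ ((Finset.Icc (-(L : ℤ)) L ×ˢ CP) ×ˢ (Finset.Icc (-(L : ℤ)) L ×ˢ CP))).filter
      (fun w : β × ((ℤ × α) × (ℤ × α)) => (w.2.1.1, w.2.2.1) ≠ (0, 0) ∧
        (w.2.1.1 ^ 2 * ((F w.2.1.2 : ℕ) : ℤ) - w.2.2.1 ^ 2 * ((F w.2.2.2 : ℕ) : ℤ)) = 0)).card ≤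
    R.card * (4 * (K * K * (((Finset.Icc 1 L ×ˢ CP.image F) ×ˢ
      (Finset.Icc 1 L ×ˢ CP.image F)).filter
      (fun v : (ℕ × ℕ) × (ℕ × ℕ) => v.1.1 ^ 2 * v.1.2 = v.2.1 ^ 2 * v.2.2)).card)) := by
  classical
  set E := (((Finset.Icc (-(L : ℤ)) L ×ˢ CP) ×ˢ (Finset.Icc (-(L : ℤ)) L ×ˢ CP))).filter
      (fun e : (ℤ × α) × (ℤ × α) => (e.1.1, e.2.1) ≠ (0, 0) ∧
        (e.1.1 ^ 2 * ((F e.1.2 : ℕ) : ℤ) - e.2.1 ^ 2 * ((F e.2.2 : ℕ) : ℤ)) = 0)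
  calc _ ≤ (R ×ˢ E).card := by
        refine card_le_card fun w hw => ?_
        rw [mem_filter, mem_product] at hw
        exact mem_product.mpr ⟨hw.1.1, mem_filter.mpr ⟨hw.1.2, hw.2⟩⟩
    _ = R.card * E.card := card_product _ _
    _ ≤ R.card * (4 * _) := Nat.mul_le_mul_left _ (de_card_signs_le CP F L hF)
    _ ≤ _ := Nat.mul_le_mul_left _ (Nat.mul_le_mul_left _ (de_card_values_le CP F L K hK))

/-- **Exact short vectors are few** (registered stub `de_card_exact_le` of the DE tool, crux
stmt-ABC-2757): the tuples `(r, ((a, Cp), (b, Dp)))` with `r ∈ subBox Qᶜ X`, `a, b ∈ [-L, L]`,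
`Cp, Dp ∈ subBox {i₀, i₁} Y × subBox {i₀, i₁} Z`, `(a, b) ≠ (0, 0)` and
`a² F(Cp) = b² F(Dp)` exactly, `F(u, v) = c₂ offVal(u) · c₃ offVal(v)`, number at most
`4 · #subBox Qᶜ X · L · (#subBox {i₀, i₁} Y · #subBox {i₀, i₁} Z) · Dτ^(4d+1)` when
`τ(m) ≤ Dτ` for `0 < m ≤ 8T³`, `L² ≤ 4T`, `c₂ V(2Y), c₃ V(2Z) ≤ T`.  Reduction to
`de_card_exact_abstract` with fibre bound `K = Dτ^d · Dτ^d` (every free coordinate of `u` and of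
`v` divides `F(u, v) ≤ T² ≤ 8T³`, `card_subBox_filter_dvd_le`) and to the landed value count
`de_card_sq_mul_eq_le` (`a² C ≤ 4T · T² ≤ 8T³`). [folklore] -/
theorem de_card_exact_le : ∀ {d : ℕ} (i₀ i₁ : Fin d) (c₂ c₃ : ℕ) (X Y Z : Fin d → ℕ) (Q : Finset (Fin d)) (L : ℕ) {T Dτ : ℕ}, (∀ m : ℕ, m ≠ 0 → m ≤ 8 * T ^ 3 → m.divisors.card ≤ Dτ) → L ^ 2 ≤ 4 * T → c₂ * shapeVal (fun j => 2 * Y j) ≤ T → c₃ * shapeVal (fun j => 2 * Z j) ≤ T → (∀ j, 0 < Y j) → (∀ j, 0 < Z j) → 0 < c₂ → 0 < c₃ → (((subBox Qᶜ X ×ˢ ((Finset.Icc (-(L : ℤ)) L ×ˢ (subBox ({i₀, i₁} : Finset (Fin d)) Y ×ˢ subBox ({i₀, i₁} : Finset (Fin d)) Z)) ×ˢ (Finset.Icc (-(L : ℤ)) L ×ˢ (subBox ({i₀, i₁} : Finset (Fin d)) Y ×ˢ subBox ({i₀, i₁} : Finset (Fin d)) Z)))).filter (fun w : (Fin d → ℕ)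 × ((ℤ × ((Fin d → ℕ) × (Fin d → ℕ))) × (ℤ × ((Fin d → ℕ) × (Fin d → ℕ)))) => (w.2.1.1, w.2.2.1) ≠ (0, 0) ∧ ((w.2.1.1 ^ 2 * ((c₂ * offVal ({i₀, i₁} : Finset (Fin d)) w.2.1.2.1 * (c₃ * offVal ({i₀, i₁} : Finset (Fin d)) w.2.1.2.2)) : ℕ) : ℤ) - (w.2.2.1 ^ 2 * ((c₂ * offVal ({i₀, i₁} : Finset (Fin d)) w.2.2.2.1 * (c₃ * offVal ({i₀, i₁} : Finset (Fin d)) w.2.2.2.2)) : ℕ) : ℤ)) = 0))).card ≤ 4 * (subBox Qᶜ X).card * L * ((subBox ({i₀, i₁} : Finset (Fin d)) Y).card * (subBox ({i₀, i₁} : Finset (Fin d)) Z).card) * Dτ ^ (4 * d + 1) := by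
  intro d i₀ i₁ c₂ c₃ X Y Z Q L T Dτ hτ hL hTY hTZ hY hZ hc₂ hc₃
  set S : Finset (Fin d) := {i₀, i₁}
  -- tuples of a sub-box: positive coordinates, positive off-value, `c · offVal ≤ T`
  have hbox : ∀ {W : Fin d → ℕ} {c : ℕ}, (∀ j, 0 < W j) → c * shapeVal (fun j => 2 * W j) ≤ T →
      ∀ u ∈ subBox S W, 0 < offVal S u ∧ c * offVal S u ≤ T := by
    intro W c hW hT u hu
    have hu' := mem_dyadicBox.mp (subBox_subset hW hu)
    have hpos : ∀ i, 0 < u i := fun i => lt_of_lt_of_le (hW i) (hu' i).1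
    have h0 : 0 < offVal S u := prod_pos fun i _ => pow_pos (hpos i) _
    refine ⟨h0, le_trans (Nat.mul_le_mul_left _ ?_) hT⟩
    calc offVal S u ≤ offVal S u * onVal S u :=
          Nat.le_mul_of_pos_right _ (prod_pos fun i _ => pow_pos (hpos i) _)
      _ = shapeVal u := (shapeVal_eq_offVal_mul_onVal S u).symm
      _ ≤ shapeVal (fun j => 2 * W j) := shapeVal_mono fun i => (hu' i).2.le
  set CP := subBox S Y ×ˢ subBox S Z with hCP
  have hT3 : T * T ≤ 8 * T ^ 3 := by
    rcases Nat.eq_zero_or_pos T with h | h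
    · simp [h]
    · calc T * T = T ^ 2 * 1 := by ring
        _ ≤ T ^ 2 * T := Nat.mul_le_mul_left _ h
        _ = 1 * T ^ 3 := by ring
        _ ≤ 8 * T ^ 3 := Nat.mul_le_mul_right _ (by norm_num)
  -- `0 < F ≤ T²` on `CP`, hence `τ(F) ≤ Dτ`
  have hFbd : ∀ p ∈ CP, 0 < c₂ * offVal S p.1 * (c₃ * offVal S p.2) ∧
      c₂ * offVal S p.1 * (c₃ * offVal S p.2) ≤ T * T := by
    intro p hp
    rw [hCP, mem_product] at hp
    obtain ⟨h01, hT1⟩ := hbox hY hTY p.1 hp.1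
    obtain ⟨h02, hT2⟩ := hbox hZ hTZ p.2 hp.2
    exact ⟨Nat.mul_pos (Nat.mul_pos hc₂ h01) (Nat.mul_pos hc₃ h02), Nat.mul_le_mul hT1 hT2⟩
  have hτF : ∀ p ∈ CP, (c₂ * offVal S p.1 * (c₃ * offVal S p.2)).divisors.card ≤ Dτ :=
    fun p hp => hτ _ (hFbd p hp).1.ne' ((hFbd p hp).2.trans hT3)
  -- the fibres of `F` on `CP` have at most `Dτ^d · Dτ^d` elements
  have hK : ∀ p ∈ CP, (CP.filter (fun p' => c₂ * offVal S p'.1 * (c₃ * offVal S p'.2) =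
      c₂ * offVal S p.1 * (c₃ * offVal S p.2))).card ≤ Dτ ^ d * Dτ ^ d := by
    intro p hp
    have hC0 : c₂ * offVal S p.1 * (c₃ * offVal S p.2) ≠ 0 := (hFbd p hp).1.ne'
    have hτC := hτF p hp
    set C := c₂ * offVal S p.1 * (c₃ * offVal S p.2)
    calc _ ≤ ((subBox S Y).filter (fun u => offVal S u ∣ C) ×ˢ
          (subBox S Z).filter (fun v => offVal S v ∣ C)).card := by
          refine card_le_card fun p' hp' => ?_
          rw [mem_filter, hCP, mem_product] at hp'
          obtain ⟨⟨h1, h2⟩, heq⟩ := hp'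
          rw [mem_product, mem_filter, mem_filter]
          exact ⟨⟨h1, ⟨c₂ * (c₃ * offVal S p'.2), by rw [← heq]; ring⟩⟩, h2,
            ⟨c₂ * offVal S p'.1 * c₃, by rw [← heq]; ring⟩⟩
      _ ≤ C.divisors.card ^ d * C.divisors.card ^ d := by
          rw [card_product]
          exact Nat.mul_le_mul
            (card_subBox_filter_dvd_le S Y hC0 (fun u => offVal S u ∣ C)
              fun u _ h i hi => (dvd_offVal S u hi).trans h)
            (card_subBox_filter_dvd_le S Z hC0 (fun v => offVal S v ∣ C)
              fun v _ h i hi => (dvd_offVal S v hi).trans h)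
      _ ≤ Dτ ^ d * Dτ ^ d := Nat.mul_le_mul (Nat.pow_le_pow_left hτC d) (Nat.pow_le_pow_left hτC d)
  -- the value set `𝒞 = F(CP)` and the hypotheses of the landed value count
  set 𝒞 := CP.image (fun p : (Fin d → ℕ) × (Fin d → ℕ) => c₂ * offVal S p.1 * (c₃ * offVal S p.2))
  have h𝒞pos : ∀ C ∈ 𝒞, 0 < C := by
    intro C hC
    obtain ⟨p, hp, rfl⟩ := mem_image.mp hC
    exact (hFbd p hp).1
  have hdiv : ∀ m : ℕ, m ≠ 0 → (∃ a ∈ Finset.Icc 1 L, ∃ C ∈ 𝒞, m = a ^ 2 * C) →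
      m.divisors.card ≤ Dτ := by
    rintro m hm ⟨a, ha, C, hC, rfl⟩
    obtain ⟨p, hp, rfl⟩ := mem_image.mp hC
    refine hτ _ hm ?_
    have haL : a ^ 2 ≤ 4 * T := (Nat.pow_le_pow_left (mem_Icc.mp ha).2 2).trans hL
    calc _ ≤ 4 * T * (T * T) := Nat.mul_le_mul haL (hFbd p hp).2
      _ = 4 * T ^ 3 := by ring
      _ ≤ 8 * T ^ 3 := Nat.mul_le_mul_right _ (by norm_num)
  have hV := de_card_sq_mul_eq_le L Dτ 𝒞 𝒞 h𝒞pos hdiv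
  have h𝒞card : 𝒞.card ≤ (subBox S Y).card * (subBox S Z).card :=
    card_image_le.trans (card_product _ _).le
  have hmain := de_card_exact_abstract (subBox Qᶜ X) CP
    (fun p : (Fin d → ℕ) × (Fin d → ℕ) => c₂ * offVal S p.1 * (c₃ * offVal S p.2)) L
    (Dτ ^ d * Dτ ^ d) (fun p hp => (hFbd p hp).1) hK
  refine hmain.trans ?_
  calc _ ≤ (subBox Qᶜ X).card * (4 * (Dτ ^ d * Dτ ^ d * (Dτ ^ d * Dτ ^ d) * (L * 𝒞.card * Dτ))) :=
        Nat.mul_le_mul_left _ (Nat.mul_le_mul_left _ (Nat.mul_le_mul_left _ hV))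
    _ ≤ (subBox Qᶜ X).card * (4 * (Dτ ^ d * Dτ ^ d * (Dτ ^ d * Dτ ^ d) *
          (L * ((subBox S Y).card * (subBox S Z).card) * Dτ))) :=
        Nat.mul_le_mul_left _ (Nat.mul_le_mul_left _ (Nat.mul_le_mul_left _
          (Nat.mul_le_mul_right _ (Nat.mul_le_mul_left _ h𝒞card))))
    _ = 4 * (subBox Qᶜ X).card * L * ((subBox S Y).card * (subBox S Z).card) *
          Dτ ^ (4 * d + 1) := by ring

end Summit.ABC.ABC.Theorems.MazurKaneLaw
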